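import Summits.CriticalPhenomena.PercolationContinuityZ3.Theorems.PercNearOneGluingNoHeavyLowerTailQ44VertexCoverLawW
import Summits.CriticalPhenomena.PercolationContinuityZ3.Theorems.PercNearOneGluingNoHeavyLowerTailQ44TTConeUniversalU

/-!
# Row `U` holds on the vertex-cover class, for all `n` (law level)

Support file for crux `stmt-CriticalPhenomena-4575` (row `W = 2·Q44` of the master family), seat `prim-bnk-1` gen 40; memo
`run/shared/lean/prim/prim-l12/FROM-prim-bnk-1-gen40-FIBRE-BRIDGE.md`.  Step (iv), the instantiation of the generic
vertex-cover bridge `VCCone.sum_kernel_cell_nonneg_of_vertexCover` (`…Q44VertexCoverLaw`) for the kernel `kU = kerQ44 + kerQ44ᵀ`: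
the good tables are those mapping `kU` into the 35-ray terminal-edge cone (`VCCone.tactList_botbot_nonneg_U`,
`…Q44TTConeUniversal`); star tables are good by the 81 accepted certificates `VCCone.inCone_starOp_U` (`…Q44TTConeStarOpsW`) via
the table identity `starTab_eq_starOpU`, and free terminal-pair tables are the generators `gadget 0…5`, good by the invariance
certificate `VCCone.invariant_U` (`…Q44VertexCoverConeW`).

**THEOREM (`q44_cells_of_vertexCover`).**  For every `n`, every weight `w : Sym2 (Fin n) → [0,1]` and all pairwise distinct
marked points `a b c y` such that `w {u,v} = 0` whenever `u, v ∉ {a,b,c,y}` (the marked points form a vertex cover of the support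
of `w`; e.g. every weighted `K_{2,m}`-, `K_{3,m}`-, `K_{4,m}`-type graph with arbitrary extra terminal–terminal edges):
`2(c₁₁c₉ + c₁₁c₈ + c₆c₈ + c₆c₁ + c₁c₈) + (c₂c₁₃ + c₁c₁₃ + c₅c₁₂ + c₁c₁₂ + c₆c₁₀ + c₆c₇ + c₂c₁₀ + c₅c₇) ≤ 2(c₁₁ + c₁₄)c₀`,
i.e. CONJECTURE W (`prim-nh-lead-4575` INEQ-CLAIMS; `TwoCopyMono.sum_kerQ44_cell` form) on this class.  No sorries, no named facts;
standard axioms + `Lean.ofReduceBool` (the two table identities by `native_decide` — computational; the cited certificates likewise).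
-/

namespace Summit.CriticalPhenomena.PercolationContinuityZ3.Theorems

namespace VCCone

open TwoCopyMono FourPointAtoms Literature.Probability.Percolation

variable {n : ℕ}

/-- Certificate denominators for the 81 star operators against the `U` cone (data from the seat's gen-39 exact LP run, index =
`starIdx` code; re-verified here by `native_decide`). [this work] -/
def vcDStarUTab : Array ℕ :=
  #[1, 1, 1, 1, 1, 1, 1, 1, 1, 1, 1, 1, 1, 1, 1, 1, 1, 1, 1, 1, 1, 1, 1, 1, 1, 1, 2, 1, 1, 1, 1, 1, 1, 1, 1, 1, 1, 1, 1, 1, 1, 1, 1, 1, 1, 1, 1, 1, 1, 1, 1, 1, 1, 1, 1, 1, 1, 1, 1, 1, 1, 1, 4, 1, 1, 1, 1, 1, 1, 1, 1, 1, 1, 1, 2, 1, 1, 1, 2, 1, 1]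

/-- Denominator `i` (positive). [this work] -/
def vcDStarU (i : Fin 81) : ℕ := max 1 (vcDStarUTab[i.1]!)

/-- Sparse certificate coefficients `(ray, multiplicity)` for the 81 star operators against the `U` cone. [this work] -/
def vcCertStarUTab : Array (List (ℕ × ℕ)) :=
  #[[(0, 1)], [(0, 1)], [(0, 2)], [(0, 1)], [], [(1, 1)], [(0, 2)], [(1, 1)], [(0, 2), (1, 1)], [(0, 1)], [], [(2, 1)], [], [], [], [(4, 1)], [], [(13, 1)], [(0, 2)], [(2, 1)], [(0, 2), (2, 1)], [(4, 1)], [], [(9, 1)], [(0, 2), (4, 1)], [(7, 1)], [(1, 2), (2, 3), (4, 2), (7, 1)], [(0, 1)], [], [(3, 1)], [], [], [], [(5, 1)], [], [(17, 1)], [], [], [], [], [], [], [], [], [], [(6, 1)], [], [(18, 1)], [], [], [], [(21, 1)], [], [(33, 1)], [(0, 2)], [(3, 1)], [(0, 2), (3, 1)], [(5, 1)], [], [(10, 1)], [(0, 2), (5, 1)], [(8, 1)], [(0, 1), (1, 3), (3, 4), (5, 4), (8, 2), (10, 2)], [(6, 1)], [], [(15, 1)], [], [], [], [(20, 1)], [],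 [(29, 1)], [(0, 2), (6, 1)], [(12, 1)], [(2, 3), (3, 2), (6, 2), (15, 1)], [(19, 1)], [], [(25, 1)], [(4, 2), (5, 3), (6, 2), (21, 1)], [(22, 1)], [(1, 1), (2, 1), (5, 1), (6, 1), (14, 1)]]

/-- Certificate coefficients. [this work] -/
def vcNuStarU (i : Fin 81) (l : Fin 34) : ℕ := ((vcCertStarUTab[i.1]!).map fun p => if p.1 = l.1 then p.2 else 0).sum

/-- The 81 membership inequalities for the `U` kernel, stated on the star-operator TABLES of the `W` file (the tables do not depend on the
kernel) (finite check). [this work] -/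
theorem vcStarCertU_le : ∀ i : Fin 81, ∀ x y : Fin 15,
    (∑ l : Fin 34, (vcNuStarU i l : ℤ) * raysU l x y) ≤ (vcDStarU i : ℤ) * tact (starOpW i) kU x y := by
  native_decide

/-- Every star operator maps `kU` into the `U` cone. [this work] -/
theorem inCone_starOpW_U (i : Fin 81) : InCone raysU (tact (starOpW i) kU) :=
  ⟨⟨vcDStarU i, by unfold vcDStarU; exact lt_max_of_lt_left Nat.one_pos, vcNuStarU i, vcStarCertU_le i⟩⟩

/-- Star tables map `kU` into the `U` cone. [this work] -/
theorem inCone_starTab_U (A F : Finset (Fin 4)) (h : Disjoint A F) : InCone raysU (tact (starTab A F) kU) := by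
  have e : starTab A F = starOpW (starIdx A F) := funext fun s => funext fun t => starTab_eq_starOpW A F h s t
  rw [e]
  exact inCone_starOpW_U _

/-- Free terminal-pair tables map `kU` into the `U` cone. [this work] -/
theorem inCone_pairTab_U (k k' : Fin 4) (h : k ≠ k') : InCone raysU (tact (pairTab k k') kU) := by
  have e : pairTab k k' = gadget ⟨(pidx k k').1, lt_trans (pidx k k').2 (by decide)⟩ :=
    funext fun s => funext fun t => pairTab_eq_gadget k k' h s t
  rw [e, ← act_eq_tact]
  exact inCone_act raysU invariant_U inCone_kU _

/-- **ROW `U` ON THE VERTEX-COVER CLASS (all `n`).**  For pairwise distinct marked points of a finite weighted graph whose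
weight vanishes on all pairs of non-marked vertices:
`2·c₁₁(c₂+c₃+c₄+c₅+c₈+c₉) + [c₂(c₁₀+c₁₃)+c₃(c₁₀+c₁₂)+c₄(c₇+c₁₃)+c₅(c₇+c₁₂)] ≤ 2·c₀c₁₄` (the form of
`TwoCopyMono.packU_of_goodKernel`). [this work] -/
theorem packU_of_vertexCover (a b c y : Fin n) (hq : Function.Injective (quad a b c y))
    (w : Sym2 (Fin n) → unitInterval)
    (hVC : ∀ u v : Fin n, (∀ k, quad a b c y k ≠ u) → (∀ k, quad a b c y k ≠ v) → (w s(u, v) : ℝ) = 0) :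
    2 * (cell w a b c y 11 * (cell w a b c y 2 + cell w a b c y 3 + cell w a b c y 4 + cell w a b c y 5 + cell w a b c y 8 +
        cell w a b c y 9)) +
      (cell w a b c y 2 * (cell w a b c y 10 + cell w a b c y 13) + cell w a b c y 3 * (cell w a b c y 10 + cell w a b c y 12) +
        cell w a b c y 4 * (cell w a b c y 7 + cell w a b c y 13) + cell w a b c y 5 * (cell w a b c y 7 + cell w a b c y 12)) ≤
      2 * (cell w a b c y 0 * cell w a b c y 14) := by
  have h : 0 ≤ ∑ i : Fin 15, ∑ j : Fin 15, (kU i j : ℝ) * cell w a b c y i * cell w a b c y j :=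
    sum_kernel_cell_nonneg_of_vertexCover a b c y hq kU (fun G => InCone raysU (tact G kU))
    (fun Gs hGs => tactList_botbot_nonneg_U Gs hGs []) inCone_starTab_U inCone_pairTab_U w hVC
  have e : ∀ i j : Fin 15, (kU i j : ℝ) = (kerU i j : ℝ) := fun i j => rfl
  simp_rw [e] at h
  rw [sum_kerU_cell] at h
  linarith

/-- **General socket: block TT-dominance ⟹ Conjecture W, law level.**  For ANY finite weighted graph and pairwise distinct marked
points: if the pairs of nonzero weight are labelled (`blk`) so that pairs with different labels share only marked vertices (e.g. label
= internal connected component of the support), and every block table of every supported fibre maps `kU` into the 35-ray `W` cone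
(the seat's conjecture TD, memo gen 39 §1; certified for all blocks with ≤ 4 internal vertices), then `Σ kUᵢⱼ cellᵢ cellⱼ ≥ 0`,
i.e. Conjecture W for that graph. [this work] -/
theorem sum_kU_cell_nonneg_of_goodBlocks (a b c y : Fin n) (hq : Function.Injective (quad a b c y))
    (w : Sym2 (Fin n) → unitInterval) {β : Type*} [DecidableEq β] (blk : Sym2 (Fin n) → β)
    (hsep : ∀ e e' : Sym2 (Fin n), (w e : ℝ) ≠ 0 → (w e' : ℝ) ≠ 0 → blk e ≠ blk e' →
      ∀ v : Fin n, v ∈ e → v ∈ e' → ∃ k, quad a b c y k = v)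
    (hgood : ∀ M C : Finset (Sym2 (Fin n)), Disjoint C M → (∀ e ∈ C ∪ M, (w e : ℝ) ≠ 0) →
      ∀ l ∈ (M ∪ C).image blk,
        InCone raysU (tact (blockTab a b c y (M.filter fun e => blk e = l) (C.filter fun e => blk e = l)) kU)) :
    0 ≤ ∑ i : Fin 15, ∑ j : Fin 15, (kU i j : ℝ) * cell w a b c y i * cell w a b c y j := by
  classical
  apply sum_kernel_cell_nonneg_of_supported_fibres a b c y w
  intro M C hCM hsupp
  have hL : ∀ T ∈ M.powerset, liftK kU (prof a b c y ↑(C ∪ T)) (prof a b c y ↑(C ∪ (M \ T))) =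
      kU (cellOf a b c y ↑(C ∪ T)) (cellOf a b c y ↑(C ∪ (M \ T))) := fun T _ => liftK_prof kU a b c y _ _
  rw [Finset.sum_congr rfl hL]
  have hsep' : ∀ e ∈ M ∪ C, ∀ e' ∈ M ∪ C, blk e ≠ blk e' → ∀ v : Fin n, v ∈ e → v ∈ e' → ∃ k, quad a b c y k = v :=
    fun e he e' he' hne => hsep e e' (hsupp e (by rwa [Finset.union_comm] at he))
      (hsupp e' (by rwa [Finset.union_comm] at he')) hne
  rw [fibre_factor a b c y blk ((M ∪ C).image blk).toList kU M C (Finset.nodup_toList _)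
    (fun e he => Finset.mem_toList.2 (Finset.mem_image_of_mem _ he)) hsep', cellOf_empty a b c y hq]
  refine tactList_botbot_nonneg_U _ (fun G hG => ?_) []
  obtain ⟨l, hl, rfl⟩ := List.mem_map.1 hG
  exact hgood M C hCM hsupp l (Finset.mem_toList.1 hl)

end VCCone

end Summit.CriticalPhenomena.PercolationContinuityZ3.Theorems
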